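import Literature.AlgebraicGeometry.Resolution.AlterationsModelExtension
import Literature.AlgebraicGeometry.Resolution.AlterationsStableModelMorphism
import Literature.AlgebraicGeometry.Resolution.AlterationsMultisectionProofs
import Literature.AlgebraicGeometry.Morphisms.GenericFibreSmooth
import HarnessLib

/-!
# De Jong's alteration theorem, 4.17/4.22: the open over which `f` is smooth, and the two renderings of the node 4.18–4.22 agree

Topic: `Literature/AlgebraicGeometry/Resolution`. Two pieces of proved bookkeeping around the
named facts `DeJong1996ModelExtensionReduction` (`AlterationsModelExtension.lean`) and
`DeJong1996StableModelToMorphism` (`AlterationsStableModelMorphism.lean`), which both vendor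
de Jong 1996, 4.18–4.21 with the opening sentences of 4.22 ("We apply the results of 4.18–4.21
and find a modification `ψ : Y' → Y`, such that `β'` extends. Once again using 4.15 we may
replace `Y` by `Y'`, etc., and assume that `β` extends to `β : 𝒞 → X` and we still have
(i)–(iv), (vi) a)–g)", p. 74) and both record, in their output, a non-empty open `U ⊆ Y` over
which `f` is SMOOTH — the `U` of 4.17:

> "4.17. Assume (i)–(iv), (vi) a)–f). We define an open subscheme `U ⊂ Y` by the formula
> `U = {y ∈ Y | X_y is smooth over y and σᵢ(y) ≠ σⱼ(y) for i ≠ j}`. By (vi) c) we have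
> `U ≠ ∅`." (p. 71)

whereas the landed rendering of (vi) g) (`DeJong1996.HasPointedSemiStableModel`) does not
record smoothness over `U`. This file PROVES:

* `DeJong1996.FibredPair.exists_smooth_morphismRestrict` — **"By (vi) c) we have `U ≠ ∅`"**:
  for a fibred pair, `f` is smooth over some non-empty open of `Y` (indeed over an open
  neighbourhood of the generic point), and `…exists_smooth_morphismRestrict_le` — inside any
  prescribed non-empty open. This is generic smoothness from the smooth generic fibre (vi) c)
  (`Literature.AlgebraicGeometry.Morphisms.exists_smooth_morphismRestrict_of_smooth_fiber_genericPoint`: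
  the points over the generic point are smooth points of `f`, EGA IV₄ 17.8.2, and `f` is
  proper, hence closed), the ingredient the discharge of either named fact needs in order to
  shrink the open of (vi) g) into the smooth locus;
* the two renderings of "the situation of 4.22 once `β` is a morphism" are the same data
  (`DeJong1996.StableModelMorphism.isUnionOfSectionsWithExtendedModel`,
  `DeJong1996.IsUnionOfSectionsWithExtendedModel.exists_stableModelMorphism`), hence **the two
  named facts are equivalent** (`DeJong1996ModelExtensionReduction.iff_stableModelToMorphism`):
  one node of the decomposition of Thm. 4.1, not two.

## Sources

* A. J. de Jong, *Smoothness, semi-stability and alterations*, Publ. Math. IHÉS 83 (1996) 51–93: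
  4.12 (vi) c) (p. 69), 4.17 (p. 71), 4.22 (p. 74).
* A. Grothendieck, EGA IV₄ (1967), 17.8.2.
-/

noncomputable section

open CategoryTheory CategoryTheory.Limits AlgebraicGeometry TopologicalSpace Topology

namespace Literature.AlgebraicGeometry.Resolution

universe u

/-! ## Shrinking the open over which a morphism is smooth -/

/-- For an open immersion `V' ↪ X` and an open `V ≤ V'`, the image of the preimage of `V` is `V`.
[folklore] -/
theorem ι_image_preimage_eq_of_le {X : Scheme.{u}} {V V' : X.Opens} (hle : V ≤ V') :
    V'.ι ''ᵁ (V'.ι ⁻¹ᵁ V) = V := by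
  rw [Scheme.Hom.image_preimage_eq_opensRange_inf, Scheme.Opens.opensRange_ι]
  exact inf_eq_right.mpr hle

/-- A property of morphisms which is local at the target passes from the restriction over an
open `V'` to the restriction over any smaller open `V ≤ V'` (restrict once more and identify
`f|_{V'}|_{V} ≅ f|_V`); the case of isomorphisms is `isIso_morphismRestrict_of_le`
(`ResolutionGlue.lean`), of finite / étale morphisms `isFinite_morphismRestrict_of_le`,
`etale_morphismRestrict_of_le`. [folklore] -/
theorem morphismRestrict_of_le {C X : Scheme.{u}} (P : MorphismProperty Scheme.{u})
    [IsZariskiLocalAtTarget P] (β : C ⟶ X) {V V' : X.Opens} (hle : V ≤ V')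
    (h : P (β ∣_ V')) : P (β ∣_ V) := by
  have h1 : P (β ∣_ V' ∣_ (V'.ι ⁻¹ᵁ V)) := IsZariskiLocalAtTarget.restrict h _
  have h2 : P (β ∣_ (V'.ι ''ᵁ (V'.ι ⁻¹ᵁ V))) :=
    (P.arrow_mk_iso_iff (morphismRestrictRestrict β V' (V'.ι ⁻¹ᵁ V))).mp h1
  exact (P.arrow_mk_iso_iff (morphismRestrictEq β (ι_image_preimage_eq_of_le hle))).mp
    h2

/-- **A morphism smooth over `V'` is smooth over every smaller open `V ≤ V'`.** [folklore] -/
theorem smooth_morphismRestrict_of_le {C X : Scheme.{u}} (f : C ⟶ X) {V V' : X.Opens}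
    (hle : V ≤ V') [Smooth (f ∣_ V')] : Smooth (f ∣_ V) :=
  morphismRestrict_of_le @Smooth f hle ‹_›

namespace DeJong1996

/-! ## 4.17: `f` is smooth over a non-empty open of `Y` -/

namespace FibredPair

variable {k : Type u} [Field k] {X Y : Scheme.{u}} [IsIntegral Y] {f : X ⟶ Y}
  {g : Y ⟶ Spec (.of k)} {Z : Set X}

/-- **de Jong 1996, 4.17: "`U = {y ∈ Y | X_y is smooth over y …}`. By (vi) c) we have
`U ≠ ∅`."** For a fibred pair, `f` is smooth over an open neighbourhood `V` of the generic point
of `Y` (in particular over a non-empty open): by (vi) c) the generic fibre is smooth, so every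
point of `X` over the generic point is a smooth point of `f`, and `f` is proper, hence closed
(`Literature.AlgebraicGeometry.Morphisms.exists_smooth_morphismRestrict_of_smooth_fiber_genericPoint`).
[cite: DeJong1996, 4.17, p. 71] -/
theorem exists_smooth_morphismRestrict (h : FibredPair f g Z) :
    ∃ V : Y.Opens, genericPoint Y ∈ V ∧ Smooth (f ∣_ V) := by
  haveI := h.isProper_fibration
  haveI := h.locallyOfFinitePresentation
  exact Literature.AlgebraicGeometry.Morphisms.exists_smooth_morphismRestrict_of_smooth_fiber_genericPoint
    f h.isCurveFibration.smooth_fiberToSpecResidueField_genericPoint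

/-- For a fibred pair and a non-empty open `U ⊆ Y` (e.g. the open of (vi) g)), there is a
non-empty open `W ⊆ U` over which `f` is smooth. [cite: DeJong1996, 4.17, p. 71] -/
theorem exists_smooth_morphismRestrict_le (h : FibredPair f g Z) (U : Y.Opens)
    (hU : (U : Set Y).Nonempty) :
    ∃ W : Y.Opens, W ≤ U ∧ (W : Set Y).Nonempty ∧ Smooth (f ∣_ W) := by
  haveI := h.isProper_fibration
  haveI := h.locallyOfFinitePresentation
  obtain ⟨W, hWU, hη, hW⟩ :=
    Literature.AlgebraicGeometry.Morphisms.exists_smooth_morphismRestrict_le_of_smooth_fiber_genericPoint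
      f h.isCurveFibration.smooth_fiberToSpecResidueField_genericPoint U hU
  exact ⟨W, hWU, ⟨_, hη⟩, hW⟩

end FibredPair

/-! ## The two renderings of "4.22 once `β` is a morphism" agree -/

/-- A situation `StableModelMorphism f g Z σ fC τ β` (`AlterationsStableModelMorphism.lean`) has
(vi) f) + g)-extended (`IsUnionOfSectionsWithExtendedModel`, `AlterationsModelExtension.lean`)
with the same `σ`, `𝒞`, `τ`, `β`. [folklore] -/
theorem StableModelMorphism.isUnionOfSectionsWithExtendedModel {k : Type u} [Field k]
    {X Y C : Scheme.{u}} [IsIntegral Y] {f : X ⟶ Y} [LocallyOfFinitePresentation f]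
    {g : Y ⟶ Spec (.of k)} {Z : Set X} {n : ℕ} {σ : Fin n → (Y ⟶ X)} {fC : C ⟶ Y}
    {τ : Fin n → (Y ⟶ C)} {β : C ⟶ X} (h : StableModelMorphism f g Z σ fC τ β) :
    IsUnionOfSectionsWithExtendedModel f g Z := by
  obtain ⟨U, hU, hsm, hiso⟩ := h.exists_isIso
  exact IsUnionOfSectionsWithExtendedModel.mk' h.injective h.σ_comp h.eq_iUnion_range
    ⟨C, fC, τ, U, β, h.isIntegral, h.isProjectiveOver, h.isPointedSemiStableCurve, hU, hsm,
      h.comp_eq, hiso, h.τ_comp⟩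

/-- Conversely, a fibred pair with (vi) e) and (vi) f) + g)-extended is a situation
`StableModelMorphism`. [folklore] -/
theorem IsUnionOfSectionsWithExtendedModel.exists_stableModelMorphism {k : Type u} [Field k]
    {X Y : Scheme.{u}} [IsIntegral Y] {f : X ⟶ Y} [LocallyOfFinitePresentation f]
    {g : Y ⟶ Spec (.of k)} {Z : Set X} (hP : FibredPair f g Z) (h3 : HasThreeSmoothPoints f Z)
    (h : IsUnionOfSectionsWithExtendedModel f g Z) :
    ∃ (C : Scheme.{u}) (n : ℕ) (σ : Fin n → (Y ⟶ X)) (fC : C ⟶ Y) (τ : Fin n → (Y ⟶ C))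
      (β : C ⟶ X), StableModelMorphism f g Z σ fC τ β := by
  obtain ⟨n, σ, -, hσ, ⟨C, p, τ, U, β, hCi, hCp, hC, hU, hsm, hβf, hiso, hτβ⟩, hZ⟩ := h
  exact ⟨C, n, σ, p, τ, β,
    { fibredPair := hP
      hasThreeSmoothPoints := h3
      σ_comp := hσ
      eq_iUnion_range := hZ
      isIntegral := hCi
      isProjectiveOver := hCp
      isPointedSemiStableCurve := hC
      comp_eq := hβf
      τ_comp := hτβ
      exists_isIso := ⟨U, hU, hsm, hiso⟩ }⟩

end DeJong1996

/-- `DeJong1996ModelExtensionReduction` implies `DeJong1996StableModelToMorphism`: an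
extended-model pair furnishes a situation `StableModelMorphism`. [folklore] -/
theorem DeJong1996ModelExtensionReduction.stableModelToMorphism
    (h : DeJong1996ModelExtensionReduction.{u}) : DeJong1996StableModelToMorphism.{u} := by
  intro k _ _ X Y _ f _ g Z hP h3 hfg hS
  refine h k X Y f g Z hP h3 hfg ?_
  intro X' Y' _ f' _ g' Z' hP' h3' hext hdim
  obtain ⟨C, n, σ, fC, τ, β, hM⟩ := hext.exists_stableModelMorphism hP' h3'
  exact hS X' Y' C f' g' Z' n σ fC τ β hM hdim

/-- `DeJong1996StableModelToMorphism` implies `DeJong1996ModelExtensionReduction`: a situation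
`StableModelMorphism` is a fibred pair with (vi) e) and (vi) f) + g)-extended. [folklore] -/
theorem DeJong1996StableModelToMorphism.modelExtensionReduction
    (h : DeJong1996StableModelToMorphism.{u}) : DeJong1996ModelExtensionReduction.{u} := by
  intro k _ _ X Y _ f _ g Z hP h3 hfg hS
  refine h k X Y f g Z hP h3 hfg ?_
  intro X' Y' C _ f' _ g' Z' n σ fC τ β hM hdim
  exact hS X' Y' f' g' Z' hM.fibredPair hM.hasThreeSmoothPoints
    hM.isUnionOfSectionsWithExtendedModel hdim

/-- **The two named renderings of de Jong 1996, 4.18–4.21 with the opening of 4.22 are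
equivalent** — one node in the decomposition of Thm. 4.1. [cite: DeJong1996, 4.18–4.22, pp. 72–74] -/
theorem DeJong1996ModelExtensionReduction.iff_stableModelToMorphism :
    DeJong1996ModelExtensionReduction.{u} ↔ DeJong1996StableModelToMorphism.{u} :=
  ⟨DeJong1996ModelExtensionReduction.stableModelToMorphism,
    DeJong1996StableModelToMorphism.modelExtensionReduction⟩

end Literature.AlgebraicGeometry.Resolution

end
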